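import Mathlib
import HarnessLib.Audit
import Summits.PneNP.PneNP.Theorems.PstarGateCaseT
import Summits.PneNP.PneNP.Theorems.PstarGateHyperplane
import Summits.PneNP.PneNP.Theorems.PstarPathRankFibre

/-!
# One GATED chord, CASE T on the gate chamber: the gate is read with polarity one and the other fundamental sets differ from `D e` only through `u` (E2 (T1); prover-1 g18)

FRONTIER range-avoidance ladder, rung F-N3 (`stmt-PneNP-19007`), cell `pnp-ideate` (this seat's `HOME/pnp-ideate-prover-1/g18/E2-PLAN.md` §4 (T1));
restricted-model proof complexity — nothing here bears on `P` versus `NP`.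

CASE T of the one-gate configuration (`PstarGateBridge.regime_trichotomy`), ONE gate on the private `p` of `e` with partner `u` (read coefficient
`ℓ(x) = κ₀ + x_u`), so the gate chamber is the coordinate hyperplane `{x_u = κ₀ + 1}`.  By `PstarGateCaseT.caseT_not_cokillable`, on that hyperplane
`Z(u_e) ∩ Z(u_{e'}) = ∅` for every other chord `e'`, i.e. `Q_{D e'} ≡ γ_{e'} + 1` on `Z(u_e) ∩ {x_u = κ₀ + 1}`.  The forcing dichotomy on the fibre
(`PstarPathRankFibre.forcing_cases_fibre`, rank `≥ 4` of `Q_{D e'}` AND of `Q_{D e}` on `coordKer {u}`) leaves two outcomes: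

* (EQ) `Q_{D e'} = u_e + κ` on the chamber ⟹ `Q_{D e ∆ D e'}` is constant there ⟹ (`PstarGateHyperplane.const_on_hyperplane`) **every edge of
  `D e ∆ D e'` passes through `u`, and `κ₀ = 1`** — the gate is read exactly where `x_u = 0` (polarity `pol = 1`, as in the PIN + GATE unit;
  `κ₀ = 0` would force `D e = D e'`, i.e. `e = e'` by `eq_of_fundamental_eq`);
* (EXC) `Q_{D e ∆ D e'} = ν₁ν₂ + κ` on the chamber with `ν₁, ν₂` affine — the rank-two coupled exception, left to the accounting.
The outcomes "`u_e ≡ 1` on the chamber" and "NOR-shaped `u_e` on the chamber" contradict rank `≥ 4` of `Q_{D e}` there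
(`PstarForcing.exists_ne_of_rank_four`, `not_rank_four_of_mul`).

* `caseT_fibre_dichotomy` — the statement above.
-/

set_option linter.dupNamespace false -- `Summit.PneNP.PneNP.…`: summit = sub-problem name (D-0017 single-conjunct layout)

open Finset Module Literature.Computability.Complexity
open scoped symmDiff
open Summit.PneNP.PneNP.Theorems.PstarTyped (Typed)
open Summit.PneNP.PneNP.Theorems.PstarSALevel (varSet bdry BoundaryExpanding SimpleOverlap)
open Summit.PneNP.PneNP.Theorems.PstarCubeIdeals (IsAffineFn isAffineFn_of_linear)
open Summit.PneNP.PneNP.Theorems.PstarProductRank (qform polar)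
open Summit.PneNP.PneNP.Theorems.PstarQuadRank (rad)
open Summit.PneNP.PneNP.Theorems.PstarForcing (exists_ne_of_rank_four not_rank_four_of_mul)
open Summit.PneNP.PneNP.Theorems.PstarQuadRestrict (quad_restrict)
open Summit.PneNP.PneNP.Theorems.PstarPathRankFibre (coordKer mem_coordKer forcing_cases_fibre)
open Summit.PneNP.PneNP.Theorems.PstarReadSumset (V2)
open Summit.PneNP.PneNP.Theorems.PstarChordSystem (ChordSystem)
open Summit.PneNP.PneNP.Theorems.PstarChordBridgeTools (privs coef)
open Summit.PneNP.PneNP.Theorems.PstarChordBridge (BridgeData sys Solution Lift)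
open Summit.PneNP.PneNP.Theorems.PstarChordBridgeForcing (gam sys_u_eq qform_add')
open Summit.PneNP.PneNP.Theorems.PstarChordBridgeFundamental (eq_of_fundamental_eq)
open Summit.PneNP.PneNP.Theorems.PstarChordBridgeKill (qform_symmDiff)
open Summit.PneNP.PneNP.Theorems.PstarGateBridge (GateHyp)
open Summit.PneNP.PneNP.Theorems.PstarGateCaseT (caseT_not_cokillable)
open Summit.PneNP.PneNP.Theorems.PstarGateHyperplane (const_on_hyperplane)

namespace Summit.PneNP.PneNP.Theorems.PstarGateCaseTLocal

variable {n m : ℕ}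

/-- Every element of `𝔽₂` is `0` or `1`. -/
private theorem zmod2_cases (t : ZMod 2) : t = 0 ∨ t = 1 := by
  revert t; decide

/-- The prescribed product `u_e = γ_e + Q_{D e}` is quadratic with the polar form of `Q_{D e}`. -/
theorem u_add (I : LocalMap 4 n m) (B : BridgeData n m) (e : Fin m) (x w : Fin n → ZMod 2) :
    (sys I B).u e (x + w) = (sys I B).u e x + (sys I B).u e w + (sys I B).u e (0 : Fin n → ZMod 2) +
      polar (B.D e) (fun j => I.vars j 2) (fun j => I.vars j 3) x w := by
  rw [sys_u_eq, sys_u_eq, sys_u_eq, sys_u_eq, qform_add' I (B.D e) x w]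
  generalize gam B e = g
  generalize qform (B.D e) (fun j => I.vars j 2) (fun j => I.vars j 3) x = a
  generalize qform (B.D e) (fun j => I.vars j 2) (fun j => I.vars j 3) w = b
  generalize qform (B.D e) (fun j => I.vars j 2) (fun j => I.vars j 3) (0 : Fin n → ZMod 2) = c
  generalize polar (B.D e) (fun j => I.vars j 2) (fun j => I.vars j 3) x w = d
  revert g a b c d; decide

/-- **CASE T, the fibre dichotomy on the gate chamber.**  See the module docstring.  Hypotheses: pure typed instance with simple overlaps,
well-formed liftable bridge data, the gate hypotheses with ONE gate of coefficient `κ₀ + x_u`, (T3), another chord `e'` read along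
`mv ∈ {(0,1),(1,1)}` (read, constant direction), and rank `≥ 4` of `Q_{D e}` and of `Q_{D e'}` on the coordinate subspace `coordKer {u}`. -/
theorem caseT_fibre_dichotomy (I : LocalMap 4 n m) (hI : I.IsPure xorAndPred) (hT : Typed I) (hS : SimpleOverlap I) {B : BridgeData n m}
    (hW : B.WF I) (hL : Lift I B) {e : Fin m} (hG : GateHyp I B e) (hT3 : ¬ ∃ z, Solution I B B.J₀ z) {mv : V2}
    (hmvT : mv = (0, 1) ∨ mv = (1, 1)) {e' : Fin m} (he' : e' ∈ B.N) (hne : e' ≠ e)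
    (hP : ∀ a, ((sys I B).ρ e' a = 0 ∨ (sys I B).ρ e' a = mv) ∧ ((sys I B).ρ' e' a = 0 ∨ (sys I B).ρ' e' a = mv))
    (hread : ∀ a, (sys I B).ρ e' a ≠ 0 ∨ (sys I B).ρ' e' a ≠ 0)
    {u : Fin n} {κ₀ : ZMod 2} (hcoef : ∀ x, coef I B.C₁ B.G₁ (I.vars e 2) x = κ₀ + x u)
    (hrD : finrank (ZMod 2) (rad ((polar (B.D e) (fun j => I.vars j 2) (fun j => I.vars j 3)).restrict (coordKer ({u} : Finset (Fin n))))) + 4 ≤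
      finrank (ZMod 2) (coordKer ({u} : Finset (Fin n))))
    (hrD' : finrank (ZMod 2) (rad ((polar (B.D e') (fun j => I.vars j 2) (fun j => I.vars j 3)).restrict (coordKer ({u} : Finset (Fin n))))) + 4 ≤
      finrank (ZMod 2) (coordKer ({u} : Finset (Fin n)))) :
    (κ₀ = 1 ∧ ∀ j ∈ B.D e ∆ B.D e', I.vars j 2 = u ∨ I.vars j 3 = u) ∨
    (∃ ν₁ ν₂ : coordKer ({u} : Finset (Fin n)) → ZMod 2, IsAffineFn ν₁ ∧ IsAffineFn ν₂ ∧ ∃ κ : ZMod 2,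
      ∀ w : coordKer ({u} : Finset (Fin n)),
        qform (B.D e ∆ B.D e') (fun j => I.vars j 2) (fun j => I.vars j 3) ((Pi.single u (κ₀ + 1) : Fin n → ZMod 2) + (w : Fin n → ZMod 2)) =
          ν₁ w * ν₂ w + κ) := by
  classical
  set W : Submodule (ZMod 2) (Fin n → ZMod 2) := coordKer ({u} : Finset (Fin n)) with hWdef
  set x₀ : Fin n → ZMod 2 := Pi.single u (κ₀ + 1) with hx₀
  set q : (Fin n → ZMod 2) → ZMod 2 := fun x => (sys I B).u e x with hq
  set Q : (Fin n → ZMod 2) → ZMod 2 := fun x => qform (B.D e') (fun j => I.vars j 2) (fun j => I.vars j 3) x with hQ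
  have hx₀u : x₀ u = κ₀ + 1 := by rw [hx₀, Pi.single_eq_same]
  -- on the chamber the coefficient is `1`
  have hcoef1 : ∀ w : W, coef I B.C₁ B.G₁ (I.vars e 2) (x₀ + w) = 1 := by
    intro w
    have hwu : (w : Fin n → ZMod 2) u = 0 := (mem_coordKer.1 w.2) u (mem_singleton_self u)
    rw [hcoef, Pi.add_apply, hx₀u, hwu, add_zero]
    have e2 : ∀ k : ZMod 2, k + (k + 1) = 1 := by decide
    exact e2 κ₀
  -- the containment on the chamber: `u_e = 0 ⟹ Q_{D e'} = γ' + 1`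
  have hZ : ∀ w : W, q (x₀ + w) = 0 → Q (x₀ + w) = gam B e' + 1 := by
    intro w hw
    have h1 : coef I B.C₁ B.G₁ (I.vars e 2) (x₀ + w) ≠ 0 := by rw [hcoef1 w]; exact one_ne_zero
    have hne0 := caseT_not_cokillable I hI hT hW hL hG hT3 hmvT he' hne (hP _) (hread _) h1 hw
    have hu1 : (sys I B).u e' (x₀ + w) = 1 := (zmod2_cases _).resolve_left hne0
    rw [sys_u_eq] at hu1
    have e1 : ∀ g Q : ZMod 2, g + Q = 1 → Q = g + 1 := by decide
    exact e1 _ _ hu1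
  have hBq : ∀ x w, q (x + w) = q x + q w + q 0 + polar (B.D e) (fun j => I.vars j 2) (fun j => I.vars j 3) x w :=
    fun x w => u_add I B e x w
  have hBQ : ∀ x w, Q (x + w) = Q x + Q w + Q 0 + polar (B.D e') (fun j => I.vars j 2) (fun j => I.vars j 3) x w :=
    fun x w => qform_add' I (B.D e') x w
  rcases forcing_cases_fibre hBq hBQ W x₀ hrD' hZ with h1 | ⟨κ, h2⟩ | ⟨ν₁, ν₂, hν₁, hν₂, κ, h3⟩ | ⟨a, b, -, hnor, -⟩
  · -- `u_e ≡ 1` on the chamber: contradicts rank four of `Q_{D e}` there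
    exfalso
    obtain ⟨v, hv⟩ := exists_ne_of_rank_four (M := W) (Q := fun w : W => q (x₀ + w)) (quad_restrict hBq W x₀) hrD
    refine hv ?_
    show q (x₀ + ↑v) = q (x₀ + ↑(0 : W))
    rw [h1 v, h1 0]
  · -- (EQ): `Q_{D e ∆ D e'}` is constant on the chamber
    left
    have hconst : ∀ x : Fin n → ZMod 2, x u = κ₀ + 1 →
        qform (B.D e ∆ B.D e') (fun j => I.vars j 2) (fun j => I.vars j 3) x = gam B e + κ := by
      intro x hxu
      have hw : x - x₀ ∈ W := by
        refine mem_coordKer.2 fun w hw => ?_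
        rw [mem_singleton.1 hw, Pi.sub_apply, hxu, hx₀u, sub_self]
      have h := h2 ⟨x - x₀, hw⟩
      simp only [hQ, hq] at h
      have hxx : x₀ + (x - x₀) = x := add_sub_cancel x₀ x
      rw [hxx, sys_u_eq] at h
      rw [qform_symmDiff, h]
      have e3 : ∀ g a k : ZMod 2, a + (g + a + k) = g + k := by decide
      exact e3 _ _ _
    obtain ⟨hthrough, hempty⟩ := const_on_hyperplane I hI hS (B.D e ∆ B.D e') u (κ₀ + 1) (gam B e + κ) hconst
    refine ⟨?_, hthrough⟩
    rcases zmod2_cases κ₀ with h0 | h1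
    · -- `κ₀ = 0`: the chamber is `{x_u = 1}`, so `D e = D e'` and `e = e'`
      exfalso
      have hDD : B.D e = B.D e' := Finset.symmDiff_eq_empty.1 (hempty (by rw [h0, zero_add]))
      have heD : e ∉ B.D e := fun h => (mem_sdiff.1 (hW.hD e hG.1 h)).2 hG.1
      have he'D : e' ∉ B.D e := fun h => (mem_sdiff.1 (hW.hD e hG.1 h)).2 he'
      have hev := hW.hDeven e hG.1
      have hev' := hW.hDeven e' he'
      rw [← hDD] at hev'
      exact hne (eq_of_fundamental_eq I hI hS heD he'D hev hev').symm
    · exact h1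
  · -- (EXC)
    right
    refine ⟨ν₁, ν₂, hν₁, hν₂, gam B e + κ, fun w => ?_⟩
    have h := h3 w
    simp only [hQ, hq] at h
    rw [sys_u_eq] at h
    rw [qform_symmDiff, h]
    have e4 : ∀ g a p k : ZMod 2, a + (g + a + p + k) = p + (g + k) := by decide
    exact e4 _ _ _ _
  · -- NOR-shaped `u_e` on the chamber: contradicts rank four of `Q_{D e}` there
    exfalso
    set Bq := (polar (B.D e) (fun j => I.vars j 2) (fun j => I.vars j 3)).restrict W with hBqdef
    have hμ₁ : IsAffineFn (fun w : W => Bq w b + (q (x₀ + b) + q (x₀ + ↑(0 : W)))) :=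
      isAffineFn_of_linear (Bq.flip b) _
    have hμ₂ : IsAffineFn (fun w : W => Bq w a + (q (x₀ + a) + q (x₀ + ↑(0 : W)))) :=
      isAffineFn_of_linear (Bq.flip a) _
    exact not_rank_four_of_mul (Q := fun w : W => q (x₀ + w)) (quad_restrict hBq W x₀) hμ₁ hμ₂ (κ := 1) (fun w => hnor w) hrD

end Summit.PneNP.PneNP.Theorems.PstarGateCaseTLocal
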